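import Summits.QuantumFields.YangMills.Theorems.BalabanUVNodesN07CentralResponseNormalForm
import Summits.QuantumFields.YangMills.Theorems.BalabanUVNodesN07CritCurrentForm
import Summits.QuantumFields.YangMills.Theorems.UnitScaleTiltProp7FibreVelocityOneStep
import Summits.QuantumFields.YangMills.Theorems.BalabanUVNodesN07CritMultiScaleChainFree
import HarnessLib

/-!
# BalabanUVNodes ∕ N07 — THE ONE-STEP CENTRAL RESPONSE IS ONTO: the linearised (0.4) average in its private coordinate `β(c)` maps the tangent space at `Ū^i U(β c)` ONTO the tangent space at
# `Ū^{i+1} U(c)` as soon as the loop variables AT `c` are within `α` of `1` (`α ≤ 1∕24`, `α < δ_N`, `157·α < |I|⁻¹`, resp. the sharp `157·α < L^{1−d}` via the route `UnitScaleTilt`'s off-central count) — file 3's `hresp` discharged LOCALLY, so that the chart road gives the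
# multi-scale tangent form (35g′) for a TOP-DOMAIN class under the per-bond `α`-guard + chain-free towers only

Cell `pub-ymgap`, width seat `pub-ymgap-dag-n07-w2` generation 2 (HUMAN RULING D-0149; DAG node N07 = [15] = [Balaban1985Variational]; W-SEAT START LIST §n07 S2, file 4b of the w2 lane's successor
pieces).  `--kind proof --supports stmt-QuantumFields-20542 --as helper` (K1⁷; count-neutral; theorems only).  CONSUMED BY NAME, nothing modified: file 4a `…N07CentralResponseNormalForm`
(`norm_centralResponse_sub_le`, `normalForm_family_self`, `hasDerivAt_coe_avgFun_expChart_single`, `fderiv_avgM_single_centralBond_eq_normalForm`), 35e `star_mul_deriv_mem_lieSU` (SU-valued curves have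
tangent velocities), `BlockAveragingEMLHaarAC.offCard_lt_card` ∕ `emlWeight`, `WilsonActionSecondVariation` (`star_coe_mul_coe_SU`, `coe_mul_star_coe_SU`, `star_coe_lieSU`), Mathlib's
`LinearMap.injective_iff_surjective`, and file 3 (`levelLifts_of_centralResponses` and its three consumers).

WHY.  By file 4a the response, pulled back to `𝔰𝔲(N)` by `Ū(c)*`, is a real-linear ENDOMORPHISM of `𝔰𝔲(N)` equal to `(1 − m∕|I|)·Ad_u + O(157α)` with `1 − m∕|I| ≥ |I|⁻¹` (there is a central
index: `offCard_lt_card`); for `157α < 1 − m∕|I|` it is injective, hence — finite dimension — onto (§3, ★★★ `centralResponse_onto_of_lt`; editions `…_onto` with `|I|⁻¹` and `…_onto_sharp` with `L^{1−d} = 1 − m∕|I|`, `Prop7FibreVelocity.offCentral_ratio_eq`).  §4 feeds file 3 at NODE 00's objects: `hresp` holds at every bond of a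
closed-below family `S` where the loop variables of the iterates are `α`-small (`centralResponses_of_loopSmall`), hence the per-level LIFTS, (45) at `U`, 35a's `IsFibreChartNear`, and ★★★ the tangent
form «curve-critical ⇒ tangent-critical» with NO displayed analytic hypothesis beyond the per-bond `α`-guard on `S` ⊇ pins and 35j's chain-free tower family `hCF` (for print's (2.3) family the latter is
n07-e's 37a `N07CritMultiScaleLamBond.chainFree_lamBond`, by name, once the fibre is indexed by a bond family).

HONEST FRAMING: kernel calculus about the tree's own averaging map; no definition; DISPLAYED HYPOTHESES on the chart road after this file: the per-bond loop smallness `dist1 ≤ α` with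
`α ≤ 1∕24`, `α < δ_N`, `157α < L^{1−d}` on a closed-below family containing the pins, and `hCF`; nothing of [15] Sects. B–F asserted; stub 1 ∕ K0⁷ NOT closed; N07 NOT discharged; counts unmoved
(5∕27); one finite T⁴ programme at fixed ε — NOT continuum ∕ ℝ⁴ ∕ OS ∕ mass gap ∕ Clay (R4 closes the conditional rung `BalabanLadder.UV` only).  No `sorry`, no `instance`, no `notation`.
-/

noncomputable section

open scoped Matrix.Norms.L2Operator Topology
open Filter

namespace Summit.QuantumFields.YangMills.BalabanUVNodes.N07CentralResponseOnto

open Literature.MathematicalPhysics.QuantumFieldTheory.Balaban1983to89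
open Literature.MathematicalPhysics.QuantumFieldTheory.Balaban1983to89.T4Continuum (T4Family)
open Literature.MathematicalPhysics.QuantumFieldTheory.Balaban1983to89.B15DeterminingSets
open Literature.MathematicalPhysics.QuantumFieldTheory.Balaban1983to89.T4AdjointCovarianceUnitary (lieSU expSU coe_expSU)
open Literature.MathematicalPhysics.QuantumFieldTheory.Balaban1983to89.BlockAveraging (Small Idx avgFun loopHol)
open Literature.MathematicalPhysics.QuantumFieldTheory.Balaban1983to89.BlockAveragingHaarAC (centralBond pre post openHol IsCentral)
open Literature.MathematicalPhysics.QuantumFieldTheory.Balaban1983to89.BlockAveragingEMLHaarAC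
  (fibreFamily fibreFamily_of_isCentral coe_fibreFamily_of_not_isCentral avgFun_update_centralBond_self fibreMap_of_mem small_update_centralBond_self_iff
   coe_avg_expMeanLogSU offCard offCard_lt_card emlWeight)
open Literature.MathematicalPhysics.QuantumFieldTheory.Balaban1983to89.ExpMeanLog (eml eml_eq_exp expMeanLogSU deltaSU differentiableAt_eml)
open Literature.MathematicalPhysics.QuantumFieldTheory.Balaban1983to89.B7TransferAnalyticMean (meanCLM meanCLM_apply)
open Literature.MathematicalPhysics.QuantumFieldTheory.Balaban1983to89.BlockAveragingEMLAnalyticMean (norm_fderiv_eml_sub_mean_le)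
open Literature.MathematicalPhysics.QuantumFieldTheory.Balaban1983to89.BlockAveragingPlaquetteBound (norm_eml_sub_one_le_six_mul)
open Literature.MathematicalPhysics.QuantumFieldTheory.Balaban1983to89.Node00
open Summit.QuantumFields.YangMills.BalabanUVNodes.N07CritTangentConverse (star_mul_deriv_mem_lieSU)
open Literature.MathematicalPhysics.QuantumFieldTheory.Balaban1983to89.B10Eq27TorusAxialLog (toUField unitsField)
open Literature.MathematicalPhysics.QuantumFieldTheory.Balaban1983to89.B10Eq68TorusRegularity (covDivT)
open Summit.QuantumFields.YangMills.Theorems.Prop7FibreVelocity (offCentral_ratio_eq)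
open Summit.QuantumFields.YangMills.BalabanUVNodes.N07CritMultiScaleChainFree (chainFree_atScale)

open Summit.QuantumFields.YangMills.BalabanUVNodes.N07CentralResponseNormalForm
  (norm_centralResponse_sub_le normalForm_family_self hasDerivAt_coe_avgFun_expChart_single fderiv_avgM_single_centralBond_eq_normalForm)

/-! ## §3  The one-step central response is ONTO (`hresp` of file 3 at one coarse bond, from the loop smallness AT that bond) -/

section Onto

variable {P : Params} {j : ℕ} {N : ℕ} [NeZero N]

/-- ★★★ **THE ONE-STEP CENTRAL RESPONSE IS ONTO.**  If the (0.4) loop variables of `U` AT `c` are within `α` of `1` with `α ≤ 1∕24`, `α < δ_N` and `157·α < |I|⁻¹` (`emlWeight`), then for every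
`Y′ ∈ 𝔰𝔲(N)` there is `Y ∈ 𝔰𝔲(N)` with `D(W ↦ avgM W c)(↑U)[U(β(c))·Y·δ_{β(c)}] = Ū(c)·Y′` — the displayed hypothesis `hresp` of `…N07CentralDescendantLifts` at `(U, c)`.  The response, pulled back to
`𝔰𝔲(N)` by `Ū(c)*`, is a real-linear endomorphism of `𝔰𝔲(N)` (SU-valued curves have tangent velocities); by §1–§2 it is `(1 − m∕|I|)·Ad + O(157α)` with `1 − m∕|I| ≥ |I|⁻¹`, hence
injective, hence onto (finite dimension).  (SU(2), `PlaqSmall` currency: the route `UnitScaleTilt`'s `Prop7FibreVelocity.norm_deriv_centralBond_sub_le` ∕ `offCentral_ratio_eq`.)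
[cite: Balaban1985Averaging, Prop. 3 (122)–(124) p.36; Balaban1987RG1, (0.4), (0.8) p.253; Balaban1985Variational, (44)–(45) p.285] -/
theorem centralResponse_onto_of_lt (hj : j + 1 ≤ P.m + P.K) (U : GaugeField P j (SU N)) (c : PBond P (j + 1)) {α : ℝ}
    (hα : ∀ i, dist1 (loopHol U c i) ≤ α) (hα24 : α ≤ 1 / 24) (hαδ : α < deltaSU (Fin N))
    (hgap : 157 * α < 1 - ((Finset.univ.filter fun i : Idx P => ¬ IsCentral c i).card : ℝ) / (Fintype.card (Idx P) : ℝ)) (Y' : lieSU (Fin N)) :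
    ∃ Y : lieSU (Fin N), fderiv ℝ (fun W : PBond P j → Matrix (Fin N) (Fin N) ℂ => avgM W c) (coeField U)
        (Pi.single (centralBond c) (((U (centralBond c) : SU N) : Matrix (Fin N) (Fin N) ℂ) * (Y : Matrix (Fin N) (Fin N) ℂ))) =
      ((avgFun (expMeanLogSU (n := Fin N)) U c : SU N) : Matrix (Fin N) (Fin N) ℂ) * (Y' : Matrix (Fin N) (Fin N) ℂ) := by
  haveI : Nonempty (Fin N) := ⟨⟨0, Nat.pos_of_ne_zero (NeZero.ne N)⟩⟩
  have hα0 : 0 ≤ α := (GaugeGroup.dist1_nonneg _).trans (hα (Classical.arbitrary _))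
  have hsmall : Small (expMeanLogSU (n := Fin N)) U c := fun i => lt_of_le_of_lt (hα i) hαδ
  set g : Matrix (Fin N) (Fin N) ℂ := ((avgFun (expMeanLogSU (n := Fin N)) U c : SU N) : Matrix (Fin N) (Fin N) ℂ) with hg
  set uβ : Matrix (Fin N) (Fin N) ℂ := ((U (centralBond c) : SU N) : Matrix (Fin N) (Fin N) ℂ) with huβ
  set L : (PBond P j → Matrix (Fin N) (Fin N) ℂ) →L[ℝ] Matrix (Fin N) (Fin N) ℂ :=
    fderiv ℝ (fun W : PBond P j → Matrix (Fin N) (Fin N) ℂ => avgM W c) (coeField U) with hL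
  have hgg : g * star g = 1 := coe_mul_star_coe_SU _
  -- the pulled-back response lands in `𝔰𝔲(N)` (velocity of an `SU(N)`-valued curve)
  have hmem : ∀ Y : lieSU (Fin N), star g * L (Pi.single (centralBond c) (uβ * (Y : Matrix (Fin N) (Fin N) ℂ))) ∈ lieSU (Fin N) := by
    intro Y
    have h := star_mul_deriv_mem_lieSU
      (γ := fun t : ℝ => avgFun (expMeanLogSU (n := Fin N)) (expChart U (t • (Pi.single (centralBond c) Y : PBond P j → lieSU (Fin N)))) c)
      (hasDerivAt_coe_avgFun_expChart_single hj U c hsmall Y)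
    simp only [zero_smul, expChart_zero] at h
    exact h
  -- the response as a real-linear endomorphism of `𝔰𝔲(N)`
  let M : lieSU (Fin N) →ₗ[ℝ] lieSU (Fin N) :=
    { toFun := fun Y => ⟨star g * L (Pi.single (centralBond c) (uβ * (Y : Matrix (Fin N) (Fin N) ℂ))), hmem Y⟩
      map_add' := fun Y₁ Y₂ => by
        apply Subtype.ext
        show star g * L (Pi.single (centralBond c) (uβ * ((Y₁ + Y₂ : lieSU (Fin N)) : Matrix (Fin N) (Fin N) ℂ))) =
          star g * L (Pi.single (centralBond c) (uβ * (Y₁ : Matrix (Fin N) (Fin N) ℂ))) + star g * L (Pi.single (centralBond c) (uβ * (Y₂ : Matrix (Fin N) (Fin N) ℂ)))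
        rw [Submodule.coe_add, mul_add, Pi.single_add, map_add, mul_add]
      map_smul' := fun r Y => by
        apply Subtype.ext
        show star g * L (Pi.single (centralBond c) (uβ * ((r • Y : lieSU (Fin N)) : Matrix (Fin N) (Fin N) ℂ))) =
          r • (star g * L (Pi.single (centralBond c) (uβ * (Y : Matrix (Fin N) (Fin N) ℂ))))
        rw [Submodule.coe_smul, mul_smul_comm, Pi.single_smul', map_smul, mul_smul_comm] }
  have hM : ∀ Y : lieSU (Fin N), ((M Y : lieSU (Fin N)) : Matrix (Fin N) (Fin N) ℂ) = star g * L (Pi.single (centralBond c) (uβ * (Y : Matrix (Fin N) (Fin N) ℂ))) :=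
    fun _ => rfl
  -- injectivity from the `157α` estimate
  have hinj : Function.Injective M := by
    rw [injective_iff_map_eq_zero]
    intro Y hY
    have hY0 : L (Pi.single (centralBond c) (uβ * (Y : Matrix (Fin N) (Fin N) ℂ))) = 0 := by
      have h1 : star g * L (Pi.single (centralBond c) (uβ * (Y : Matrix (Fin N) (Fin N) ℂ))) = 0 := by
        rw [← hM, hY]; rfl
      calc L (Pi.single (centralBond c) (uβ * (Y : Matrix (Fin N) (Fin N) ℂ)))
          = g * (star g * L (Pi.single (centralBond c) (uβ * (Y : Matrix (Fin N) (Fin N) ℂ)))) := by rw [← mul_assoc, hgg, one_mul]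
        _ = 0 := by rw [h1, mul_zero]
    -- the private-coordinate letters (opaque local names)
    obtain ⟨u, hu⟩ : ∃ u : Matrix (Fin N) (Fin N) ℂ, u = ((pre U c : SU N) : Matrix (Fin N) (Fin N) ℂ) * uβ := ⟨_, rfl⟩
    obtain ⟨W₀, hW₀⟩ : ∃ W₀ : Matrix (Fin N) (Fin N) ℂ, W₀ = ((pre U c : SU N) : Matrix (Fin N) (Fin N) ℂ) * uβ * ((post U c : SU N) : Matrix (Fin N) (Fin N) ℂ) := ⟨_, rfl⟩
    obtain ⟨Xm, hXm⟩ : ∃ Xm : Matrix (Fin N) (Fin N) ℂ, Xm = u * (Y : Matrix (Fin N) (Fin N) ℂ) * star u := ⟨_, rfl⟩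
    have hu1 : star u * u = 1 := by rw [hu, huβ, ← Submonoid.coe_mul]; exact star_coe_mul_coe_SU _
    have hW₀u : W₀ * star W₀ = 1 := by rw [hW₀, huβ, ← Submonoid.coe_mul, ← Submonoid.coe_mul]; exact coe_mul_star_coe_SU _
    have hXskew : star Xm = -Xm := by
      rw [hXm]
      simp only [star_mul, star_star, star_coe_lieSU, neg_mul, mul_neg, mul_assoc]
    have hpu1 : star (((pre U c : SU N) : Matrix (Fin N) (Fin N) ℂ) * uβ) * (((pre U c : SU N) : Matrix (Fin N) (Fin N) ℂ) * uβ) = 1 := by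
      rw [← hu]; exact hu1
    have hXW : ((pre U c : SU N) : Matrix (Fin N) (Fin N) ℂ) * (uβ * (Y : Matrix (Fin N) (Fin N) ℂ)) * ((post U c : SU N) : Matrix (Fin N) (Fin N) ℂ) = Xm * W₀ := by
      rw [hXm, hW₀, hu]
      calc ((pre U c : SU N) : Matrix (Fin N) (Fin N) ℂ) * (uβ * (Y : Matrix (Fin N) (Fin N) ℂ)) * ((post U c : SU N) : Matrix (Fin N) (Fin N) ℂ)
          = ((pre U c : SU N) : Matrix (Fin N) (Fin N) ℂ) * uβ * (Y : Matrix (Fin N) (Fin N) ℂ) *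
              (star (((pre U c : SU N) : Matrix (Fin N) (Fin N) ℂ) * uβ) * (((pre U c : SU N) : Matrix (Fin N) (Fin N) ℂ) * uβ)) *
              ((post U c : SU N) : Matrix (Fin N) (Fin N) ℂ) := by rw [hpu1]; noncomm_ring
        _ = _ := by noncomm_ring
    have hh : ∀ i, ¬ IsCentral c i → ‖((openHol U c i : SU N) : Matrix (Fin N) (Fin N) ℂ) * star W₀ - 1‖ ≤ α := fun i hc => by
      rw [hW₀, huβ, normalForm_family_self hj U c i hc, ← FederbushMean.dist1_SU_eq]; exact hα i
    have hest := norm_centralResponse_sub_le (IsCentral c) (fun i => ((openHol U c i : SU N) : Matrix (Fin N) (Fin N) ℂ)) W₀ Xm hα0 hα24 hh hW₀u hXskew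
    have hRΦ := fderiv_avgM_single_centralBond_eq_normalForm hj U c hsmall Y
    rw [hXW] at hRΦ
    rw [← huβ, ← hL, hY0, ← hW₀] at hRΦ
    rw [← hRΦ, zero_mul, zero_sub] at hest
    -- `‖Xm‖·(1 − m∕|I|) ≤ 157 α ‖Xm‖` with `1 − m∕|I| ≥ |I|⁻¹ > 157 α`
    set m : ℕ := (Finset.univ.filter fun i => ¬ IsCentral c i).card with hm
    have hsm : ‖(((m : ℂ)) / (Fintype.card (Idx P) : ℂ)) • Xm‖ = (m : ℝ) / Fintype.card (Idx P) * ‖Xm‖ := by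
      rw [norm_smul, norm_div, Complex.norm_natCast, Complex.norm_natCast]
    have htri : ‖Xm‖ ≤ ‖-Xm + (((m : ℂ)) / (Fintype.card (Idx P) : ℂ)) • Xm‖ + (m : ℝ) / Fintype.card (Idx P) * ‖Xm‖ := by
      rw [← hsm]
      calc ‖Xm‖ = ‖-Xm‖ := (norm_neg _).symm
        _ = ‖(-Xm + (((m : ℂ)) / (Fintype.card (Idx P) : ℂ)) • Xm) - (((m : ℂ)) / (Fintype.card (Idx P) : ℂ)) • Xm‖ := by rw [add_sub_cancel_right]
        _ ≤ _ := norm_sub_le _ _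
    have hXm0 : ‖Xm‖ = 0 := by
      have h1 : ‖Xm‖ * (1 - (m : ℝ) / Fintype.card (Idx P)) ≤ 157 * α * ‖Xm‖ := by nlinarith [htri, hest, norm_nonneg Xm]
      have h2 : 157 * α < 1 - (m : ℝ) / Fintype.card (Idx P) := hgap
      nlinarith [norm_nonneg Xm, h1, h2]
    have hXm' : Xm = 0 := norm_eq_zero.1 hXm0
    have hYm : (Y : Matrix (Fin N) (Fin N) ℂ) = 0 := by
      calc (Y : Matrix (Fin N) (Fin N) ℂ) = (star u * u) * (Y : Matrix (Fin N) (Fin N) ℂ) * (star u * u) := by rw [hu1, one_mul, mul_one]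
        _ = star u * (u * (Y : Matrix (Fin N) (Fin N) ℂ) * star u) * u := by noncomm_ring
        _ = 0 := by rw [← hXm, hXm', mul_zero, zero_mul]
    exact Subtype.ext hYm
  -- onto by dimension, and the conclusion
  have hsurj : Function.Surjective M := LinearMap.injective_iff_surjective.1 hinj
  obtain ⟨Y, hY⟩ := hsurj Y'
  refine ⟨Y, ?_⟩
  have h1 : star g * L (Pi.single (centralBond c) (uβ * (Y : Matrix (Fin N) (Fin N) ℂ))) = (Y' : Matrix (Fin N) (Fin N) ℂ) := by
    rw [← hM, hY]
  calc L (Pi.single (centralBond c) (uβ * (Y : Matrix (Fin N) (Fin N) ℂ)))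
      = g * (star g * L (Pi.single (centralBond c) (uβ * (Y : Matrix (Fin N) (Fin N) ℂ)))) := by rw [← mul_assoc, hgg, one_mul]
    _ = g * (Y' : Matrix (Fin N) (Fin N) ℂ) := by rw [h1]

/-- ★★★ **THE ONE-STEP CENTRAL RESPONSE IS ONTO — `|I|⁻¹` edition** (there is at least one central index, `BlockAveragingEMLHaarAC.offCard_lt_card`, so `1 − m∕|I| ≥ |I|⁻¹ = emlWeight`).
[cite: Balaban1985Averaging, Prop. 3 (124) p.36; Balaban1987RG1, (0.4), (0.8) p.253] -/
theorem centralResponse_onto (hj : j + 1 ≤ P.m + P.K) (U : GaugeField P j (SU N)) (c : PBond P (j + 1)) {α : ℝ}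
    (hα : ∀ i, dist1 (loopHol U c i) ≤ α) (hα24 : α ≤ 1 / 24) (hαδ : α < deltaSU (Fin N)) (hαI : 157 * α < emlWeight P) (Y' : lieSU (Fin N)) :
    ∃ Y : lieSU (Fin N), fderiv ℝ (fun W : PBond P j → Matrix (Fin N) (Fin N) ℂ => avgM W c) (coeField U)
        (Pi.single (centralBond c) (((U (centralBond c) : SU N) : Matrix (Fin N) (Fin N) ℂ) * (Y : Matrix (Fin N) (Fin N) ℂ))) =
      ((avgFun (expMeanLogSU (n := Fin N)) U c : SU N) : Matrix (Fin N) (Fin N) ℂ) * (Y' : Matrix (Fin N) (Fin N) ℂ) := by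
  refine centralResponse_onto_of_lt hj U c hα hα24 hαδ (lt_of_lt_of_le hαI ?_) Y'
  have hcard : 0 < Fintype.card (Idx P) := Fintype.card_pos
  have hcR : (0 : ℝ) < Fintype.card (Idx P) := by exact_mod_cast hcard
  have hmlt : (Finset.univ.filter fun i : Idx P => ¬ IsCentral c i).card < Fintype.card (Idx P) := by
    have h := offCard_lt_card c
    simpa [offCard, Fintype.card_subtype] using h
  rw [emlWeight, le_sub_comm, div_le_iff₀ hcR, sub_mul, inv_mul_cancel₀ hcR.ne', one_mul]
  have : (((Finset.univ.filter fun i : Idx P => ¬ IsCentral c i).card : ℝ)) + 1 ≤ Fintype.card (Idx P) := by exact_mod_cast hmlt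
  linarith

/-- ★★★ **THE ONE-STEP CENTRAL RESPONSE IS ONTO — sharp `L^{1−d}` edition**: the off-central fraction is EXACTLY `1 − L^{1−d}` (route `UnitScaleTilt`'s `Prop7FibreVelocity.offCentral_ratio_eq`), so
`157·α < L^{1−d}` suffices. [cite: Balaban1985Averaging, Prop. 3 (124) p.36; Balaban1987RG1, (0.4), (0.8) p.253] -/
theorem centralResponse_onto_sharp (hj : j + 1 ≤ P.m + P.K) (U : GaugeField P j (SU N)) (c : PBond P (j + 1)) {α : ℝ}
    (hα : ∀ i, dist1 (loopHol U c i) ≤ α) (hα24 : α ≤ 1 / 24) (hαδ : α < deltaSU (Fin N)) (hαL : 157 * α < ((P.L : ℝ) ^ (P.d - 1))⁻¹) (Y' : lieSU (Fin N)) :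
    ∃ Y : lieSU (Fin N), fderiv ℝ (fun W : PBond P j → Matrix (Fin N) (Fin N) ℂ => avgM W c) (coeField U)
        (Pi.single (centralBond c) (((U (centralBond c) : SU N) : Matrix (Fin N) (Fin N) ℂ) * (Y : Matrix (Fin N) (Fin N) ℂ))) =
      ((avgFun (expMeanLogSU (n := Fin N)) U c : SU N) : Matrix (Fin N) (Fin N) ℂ) * (Y' : Matrix (Fin N) (Fin N) ℂ) := by
  refine centralResponse_onto_of_lt hj U c hα hα24 hαδ ?_ Y'
  rw [offCentral_ratio_eq c, sub_sub_cancel]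
  exact hαL

end Onto

/-! ## §4  At NODE 00's objects: `hresp` on a guarded closed-below family, and the chart road's three consumers under the per-bond `α`-guard + chain-free towers only -/

section Record

variable {F : T4Family} {N : ℕ} [NeZero N] {K k : ℕ} {𝔹 : DetSet (F.P K)} {W : MSField (F.P K) (SU N)} {U : GaugeField (F.P K) 0 (SU N)}

/-- ★★ **`hresp` OF FILE 3 DISCHARGED ON A GUARDED FAMILY**: if the loop variables of `Ū^i U` AT every `c ∈ S_{i+1}`, `i + 1 ≤ k` (standing range), are within `α` of `1` with `α ≤ 1∕24`,
`α < δ_N`, `157α < L^{1−d}`, then the one-step central response at every such `(i, c)` is onto (sharp edition). [cite: Balaban1985Averaging, Prop. 3 (124) p.36; Balaban1987RG1, (0.4), (0.8) p.253] -/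
theorem centralResponses_of_loopSmall (hk : k ≤ (F.P K).m + (F.P K).K) (S : (i : ℕ) → Set (PBond (F.P K) i)) {α : ℝ}
    (hα : ∀ (i : ℕ) (c : PBond (F.P K) (i + 1)), i + 1 ≤ k → c ∈ S (i + 1) → ∀ idx : Idx (F.P K), dist1 (loopHol (avgFamily (avOfRecord F N K) U i) c idx) ≤ α)
    (hα24 : α ≤ 1 / 24) (hαδ : α < deltaSU (Fin N)) (hαL : 157 * α < (((F.P K).L : ℝ) ^ ((F.P K).d - 1))⁻¹) :
    ∀ (i : ℕ) (c : PBond (F.P K) (i + 1)), i + 1 ≤ k → c ∈ S (i + 1) → ∀ Y' : lieSU (Fin N), ∃ Y : lieSU (Fin N),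
      fderiv ℝ (fun W : PBond (F.P K) i → Matrix (Fin N) (Fin N) ℂ => avgM W c) (coeField (avgFamily (avOfRecord F N K) U i))
          (Pi.single (centralBond c) (((avgFamily (avOfRecord F N K) U i (centralBond c) : SU N) : Matrix (Fin N) (Fin N) ℂ) * (Y : Matrix (Fin N) (Fin N) ℂ))) =
        ((avgFamily (avOfRecord F N K) U (i + 1) c : SU N) : Matrix (Fin N) (Fin N) ℂ) * (Y' : Matrix (Fin N) (Fin N) ℂ) :=
  fun i c hi hc Y' => centralResponse_onto_sharp (hi.trans hk) (avgFamily (avOfRecord F N K) U i) c (hα i c hi hc) hα24 hαδ hαL Y'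

/-- The `α`-smallness of the loop variables implies the (0.4) guard (`α < δ_N`). [cite: Balaban1987RG1, (0.4) p.253 (bookkeeping)] -/
theorem small_of_loopSmall (S : (i : ℕ) → Set (PBond (F.P K) i)) {α : ℝ}
    (hα : ∀ (i : ℕ) (c : PBond (F.P K) (i + 1)), i + 1 ≤ k → c ∈ S (i + 1) → ∀ idx : Idx (F.P K), dist1 (loopHol (avgFamily (avOfRecord F N K) U i) c idx) ≤ α)
    (hαδ : α < deltaSU (Fin N)) :
    ∀ (i : ℕ) (c : PBond (F.P K) (i + 1)), i + 1 ≤ k → c ∈ S (i + 1) → Small (expMeanLogSU (n := Fin N)) (avgFamily (avOfRecord F N K) U i) c :=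
  fun i c hi hc idx => lt_of_le_of_lt (hα i c hi hc idx) hαδ

open N07CentralDescendantLifts (levelLifts_of_centralResponses exists_velocity_preimage_of_centralResponses isFibreChartNear_msChart_of_centralResponses
  hasDerivAt_wilsonAction4_expChart_of_isCritOnFibre_of_centralResponses)

/-- ★★★ **THE PER-LEVEL LIFTS UNDER THE PER-BOND `α`-GUARD + CHAIN-FREE TOWERS** (file 3's `levelLifts_of_centralResponses` with `hresp` supplied by §3): `hlift` of `…N07MultiScaleLiftsRightInverse`
with NO displayed analytic hypothesis beyond the local loop smallness on `S` and 35j's `hCF`. [cite: Balaban1985Variational, (45) p.285, (83) p.290; Balaban1984PropagatorsII, p.228] -/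
theorem levelLifts_of_loopSmall (hk : k ≤ (F.P K).m + (F.P K).K) (hU : AgreeOn 𝔹 (avgFamily (avOfRecord F N K) U) W)
    (S : (i : ℕ) → Set (PBond (F.P K) i))
    (hS : ∀ (i : ℕ) (c : PBond (F.P K) (i + 1)), i + 1 ≤ k → c ∈ S (i + 1) → ∀ b : PBond (F.P K) i, (blockOf b.src = c.src ∨ blockOf b.src = c.tgt) → b ∈ S i)
    {α : ℝ} (hα : ∀ (i : ℕ) (c : PBond (F.P K) (i + 1)), i + 1 ≤ k → c ∈ S (i + 1) → ∀ idx : Idx (F.P K), dist1 (loopHol (avgFamily (avOfRecord F N K) U i) c idx) ≤ α)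
    (hα24 : α ≤ 1 / 24) (hαδ : α < deltaSU (Fin N)) (hαL : 157 * α < (((F.P K).L : ℝ) ^ ((F.P K).d - 1))⁻¹)
    (h𝔹S : ∀ j, j ≤ k → bondsOf (𝔹 j) ⊆ S j)
    (hCF : ∀ ℓ, ℓ ≤ k → ∃ T : (i : ℕ) → Set (PBond (F.P K) i), bondsOf (𝔹 ℓ) ⊆ T ℓ ∧ (∀ i, i < ℓ → ∀ c : PBond (F.P K) (i + 1), c ∈ T (i + 1) → centralBond c ∈ T i) ∧ ∀ j, j < ℓ → Disjoint (T j) (bondsOf (𝔹 j))) :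
    ∀ j, j ≤ k → ∀ σ : PBond (F.P K) j → lieSU (Fin N), ∃ X : PBond (F.P K) 0 → lieSU (Fin N),
      (∀ c ∈ bondsOf (𝔹 j), HasDerivAt (fun t : ℝ => ((avgFamily (avOfRecord F N K) (expChart U (t • X)) j c : SU N) : Matrix (Fin N) (Fin N) ℂ))
        (((W j c : SU N) : Matrix (Fin N) (Fin N) ℂ) * ((σ c : lieSU (Fin N)) : Matrix (Fin N) (Fin N) ℂ)) 0) ∧
      (∀ i, i < j → ∀ c ∈ bondsOf (𝔹 i), HasDerivAt (fun t : ℝ => ((avgFamily (avOfRecord F N K) (expChart U (t • X)) i c : SU N) : Matrix (Fin N) (Fin N) ℂ)) 0 0) :=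
  levelLifts_of_centralResponses hk hU S hS (small_of_loopSmall S hα hαδ) h𝔹S hCF (centralResponses_of_loopSmall hk S hα hα24 hαδ hαL)

/-- ★★ **(45) AT `U` UNDER THE PER-BOND `α`-GUARD + CHAIN-FREE TOWERS.** [cite: Balaban1985Variational, (45) p.285, (83) p.290; Balaban1984PropagatorsII, p.228] -/
theorem exists_velocity_preimage_of_loopSmall (hk : k ≤ (F.P K).m + (F.P K).K) (hU : AgreeOn 𝔹 (avgFamily (avOfRecord F N K) U) W)
    (S : (i : ℕ) → Set (PBond (F.P K) i))
    (hS : ∀ (i : ℕ) (c : PBond (F.P K) (i + 1)), i + 1 ≤ k → c ∈ S (i + 1) → ∀ b : PBond (F.P K) i, (blockOf b.src = c.src ∨ blockOf b.src = c.tgt) → b ∈ S i)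
    {α : ℝ} (hα : ∀ (i : ℕ) (c : PBond (F.P K) (i + 1)), i + 1 ≤ k → c ∈ S (i + 1) → ∀ idx : Idx (F.P K), dist1 (loopHol (avgFamily (avOfRecord F N K) U i) c idx) ≤ α)
    (hα24 : α ≤ 1 / 24) (hαδ : α < deltaSU (Fin N)) (hαL : 157 * α < (((F.P K).L : ℝ) ^ ((F.P K).d - 1))⁻¹)
    (h𝔹S : ∀ j, j ≤ k → bondsOf (𝔹 j) ⊆ S j)
    (hCF : ∀ ℓ, ℓ ≤ k → ∃ T : (i : ℕ) → Set (PBond (F.P K) i), bondsOf (𝔹 ℓ) ⊆ T ℓ ∧ (∀ i, i < ℓ → ∀ c : PBond (F.P K) (i + 1), c ∈ T (i + 1) → centralBond c ∈ T i) ∧ ∀ j, j < ℓ → Disjoint (T j) (bondsOf (𝔹 j)))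
    (τ : (j : ℕ) → PBond (F.P K) j → lieSU (Fin N)) :
    ∃ X : PBond (F.P K) 0 → lieSU (Fin N), ∀ j, j ≤ k → ∀ c ∈ bondsOf (𝔹 j),
      HasDerivAt (fun t : ℝ => ((avgFamily (avOfRecord F N K) (expChart U (t • X)) j c : SU N) : Matrix (Fin N) (Fin N) ℂ))
        (((W j c : SU N) : Matrix (Fin N) (Fin N) ℂ) * ((τ j c : lieSU (Fin N)) : Matrix (Fin N) (Fin N) ℂ)) 0 :=
  exists_velocity_preimage_of_centralResponses hk hU S hS (small_of_loopSmall S hα hαδ) h𝔹S hCF (centralResponses_of_loopSmall hk S hα hα24 hαδ hαL) τ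

/-- ★★ **35a's `IsFibreChartNear` FOR THE CANONICAL MULTI-SCALE CHART UNDER THE PER-BOND `α`-GUARD + CHAIN-FREE TOWERS.**
[cite: Balaban1985Variational, (45)–(48) p.285, Prop. 3 p.289, (82)–(83) p.290; Balaban1988Convergent, (2.10)–(2.12) p.256] -/
theorem isFibreChartNear_msChart_of_loopSmall (h𝔹 : ∀ j, k < j → 𝔹 j = ∅) (hk : k ≤ (F.P K).m + (F.P K).K) (hU : AgreeOn 𝔹 (avgFamily (avOfRecord F N K) U) W)
    (S : (i : ℕ) → Set (PBond (F.P K) i))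
    (hS : ∀ (i : ℕ) (c : PBond (F.P K) (i + 1)), i + 1 ≤ k → c ∈ S (i + 1) → ∀ b : PBond (F.P K) i, (blockOf b.src = c.src ∨ blockOf b.src = c.tgt) → b ∈ S i)
    {α : ℝ} (hα : ∀ (i : ℕ) (c : PBond (F.P K) (i + 1)), i + 1 ≤ k → c ∈ S (i + 1) → ∀ idx : Idx (F.P K), dist1 (loopHol (avgFamily (avOfRecord F N K) U i) c idx) ≤ α)
    (hα24 : α ≤ 1 / 24) (hαδ : α < deltaSU (Fin N)) (hαL : 157 * α < (((F.P K).L : ℝ) ^ ((F.P K).d - 1))⁻¹)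
    (h𝔹S : ∀ j, j ≤ k → bondsOf (𝔹 j) ⊆ S j)
    (hCF : ∀ ℓ, ℓ ≤ k → ∃ T : (i : ℕ) → Set (PBond (F.P K) i), bondsOf (𝔹 ℓ) ⊆ T ℓ ∧ (∀ i, i < ℓ → ∀ c : PBond (F.P K) (i + 1), c ∈ T (i + 1) → centralBond c ∈ T i) ∧ ∀ j, j < ℓ → Disjoint (T j) (bondsOf (𝔹 j))) :
    IsFibreChartNear F N K 𝔹 W U (msChart F N K k 𝔹 W U) (fderiv ℝ (msChart F N K k 𝔹 W U) 0) :=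
  isFibreChartNear_msChart_of_centralResponses h𝔹 hk hU S hS (small_of_loopSmall S hα hαδ) h𝔹S hCF (centralResponses_of_loopSmall hk S hα hα24 hαδ hαL)

/-- ★★★ **CURVE-CRITICAL ⇒ TANGENT-CRITICAL ON A MULTI-SCALE FIBRE — THE CHART ROAD, LOCAL FORM, WITH NO DISPLAYED ANALYTIC HYPOTHESIS**: `𝐁` level-bounded in the standing range with pins in a
closed-below family `S`, the (0.4) loop variables of the iterates `Ū^i U` within `α` of `1` AT the bonds of `S` only (`α ≤ 1∕24`, `α < δ_N`, `157α < L^{1−d}`), 35j's chain-free towers, `U` in the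
fibre and curve-critical for (5) there ⇒ `d∕dt A(U·exp(tX))∣₀ = 0` for every joint-kernel direction `X` — print's (82) on (83) for a TOP-DOMAIN class (no whole-torus guard).
[cite: Balaban1985Variational, (82)–(83) p.290, (141) p.299, Prop. 8 p.304, (45) p.285; Balaban1987RG1, (0.4), (0.8) p.253; Balaban1988Convergent, (2.10)–(2.12) p.256] -/
theorem hasDerivAt_wilsonAction4_expChart_of_isCritOnFibre_of_loopSmall (h𝔹 : ∀ j, k < j → 𝔹 j = ∅) (hk : k ≤ (F.P K).m + (F.P K).K)
    (hU : AgreeOn 𝔹 (avgFamily (avOfRecord F N K) U) W)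
    (S : (i : ℕ) → Set (PBond (F.P K) i))
    (hS : ∀ (i : ℕ) (c : PBond (F.P K) (i + 1)), i + 1 ≤ k → c ∈ S (i + 1) → ∀ b : PBond (F.P K) i, (blockOf b.src = c.src ∨ blockOf b.src = c.tgt) → b ∈ S i)
    {α : ℝ} (hα : ∀ (i : ℕ) (c : PBond (F.P K) (i + 1)), i + 1 ≤ k → c ∈ S (i + 1) → ∀ idx : Idx (F.P K), dist1 (loopHol (avgFamily (avOfRecord F N K) U i) c idx) ≤ α)
    (hα24 : α ≤ 1 / 24) (hαδ : α < deltaSU (Fin N)) (hαL : 157 * α < (((F.P K).L : ℝ) ^ ((F.P K).d - 1))⁻¹)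
    (h𝔹S : ∀ j, j ≤ k → bondsOf (𝔹 j) ⊆ S j)
    (hCF : ∀ ℓ, ℓ ≤ k → ∃ T : (i : ℕ) → Set (PBond (F.P K) i), bondsOf (𝔹 ℓ) ⊆ T ℓ ∧ (∀ i, i < ℓ → ∀ c : PBond (F.P K) (i + 1), c ∈ T (i + 1) → centralBond c ∈ T i) ∧ ∀ j, j < ℓ → Disjoint (T j) (bondsOf (𝔹 j)))
    (hcrit : IsCritOnFibre F N K 𝔹 W U) {X : PBond (F.P K) 0 → lieSU (Fin N)}
    (hX : ∀ j, j ≤ k → ∀ c ∈ bondsOf (𝔹 j),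
      HasDerivAt (fun t : ℝ => ((avgFamily (avOfRecord F N K) (expChart U (t • X)) j c : SU N) : Matrix (Fin N) (Fin N) ℂ)) 0 0) :
    HasDerivAt (fun t : ℝ => wilsonAction4 (expChart U (t • X))) 0 0 :=
  hasDerivAt_wilsonAction4_expChart_of_isCritOnFibre_of_centralResponses h𝔹 hk hU S hS (small_of_loopSmall S hα hαδ) h𝔹S hCF
    (centralResponses_of_loopSmall hk S hα hα24 hαδ hαL) hcrit hX


/-- ★★★ **THE (141) CURRENT FORM FOR A TOP-DOMAIN CLASS**: under the per-bond `α`-guard on `S` ⊇ pins and 35j's chain-free towers, a curve-critical `U` in the fibre satisfies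
`Σ_b Re Tr(U_bX_bU_b⋆ · η(D^{η*}_U∂U)(b)) = 0` for every joint-kernel direction `X` (n07-e's 35g `sum_re_trace_covDivT_eq_zero_of_hasDerivAt_zero` after the tangent form above) — print's
«⟨δA′, J⟩ = 0 for all δA′ : QδA′ = 0» with no whole-torus guard. [cite: Balaban1985Variational, (2),(5) p.278, (141) p.299, p.300; Balaban1985RegularSpaces, (1.1)–(1.2) p.76] -/
theorem sum_re_trace_covDivT_eq_zero_of_isCritOnFibre_of_loopSmall (h𝔹 : ∀ j, k < j → 𝔹 j = ∅) (hk : k ≤ (F.P K).m + (F.P K).K)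
    (hU : AgreeOn 𝔹 (avgFamily (avOfRecord F N K) U) W)
    (S : (i : ℕ) → Set (PBond (F.P K) i))
    (hS : ∀ (i : ℕ) (c : PBond (F.P K) (i + 1)), i + 1 ≤ k → c ∈ S (i + 1) → ∀ b : PBond (F.P K) i, (blockOf b.src = c.src ∨ blockOf b.src = c.tgt) → b ∈ S i)
    {α : ℝ} (hα : ∀ (i : ℕ) (c : PBond (F.P K) (i + 1)), i + 1 ≤ k → c ∈ S (i + 1) → ∀ idx : Idx (F.P K), dist1 (loopHol (avgFamily (avOfRecord F N K) U i) c idx) ≤ α)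
    (hα24 : α ≤ 1 / 24) (hαδ : α < deltaSU (Fin N)) (hαL : 157 * α < (((F.P K).L : ℝ) ^ ((F.P K).d - 1))⁻¹)
    (h𝔹S : ∀ j, j ≤ k → bondsOf (𝔹 j) ⊆ S j)
    (hCF : ∀ ℓ, ℓ ≤ k → ∃ T : (i : ℕ) → Set (PBond (F.P K) i), bondsOf (𝔹 ℓ) ⊆ T ℓ ∧ (∀ i, i < ℓ → ∀ c : PBond (F.P K) (i + 1), c ∈ T (i + 1) → centralBond c ∈ T i) ∧ ∀ j, j < ℓ → Disjoint (T j) (bondsOf (𝔹 j)))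
    (hcrit : IsCritOnFibre F N K 𝔹 W U) {X : PBond (F.P K) 0 → lieSU (Fin N)}
    (hX : ∀ j, j ≤ k → ∀ c ∈ bondsOf (𝔹 j),
      HasDerivAt (fun t : ℝ => ((avgFamily (avOfRecord F N K) (expChart U (t • X)) j c : SU N) : Matrix (Fin N) (Fin N) ℂ)) 0 0)
    {η : ℝ} (hη : η ≠ 0) :
    ∑ b : PBond (F.P K) 0, (Matrix.trace (((U b : SU N) : Matrix (Fin N) (Fin N) ℂ) * (X b : Matrix (Fin N) (Fin N) ℂ) * star ((U b : SU N) : Matrix (Fin N) (Fin N) ℂ) *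
      (η • covDivT η (unitsField (toUField U)) b.dir b.src))).re = 0 :=
  N07CritCurrentForm.sum_re_trace_covDivT_eq_zero_of_hasDerivAt_zero U X hη
    (hasDerivAt_wilsonAction4_expChart_of_isCritOnFibre_of_loopSmall h𝔹 hk hU S hS hα hα24 hαδ hαL h𝔹S hCF hcrit hX)

/-- **CONSISTENCY CERTIFICATE (A6): THE ONE-SCALE PIN UNDER WHOLE-TORUS PLAQUETTE SMALLNESS INHABITS EVERY HYPOTHESIS** — `S ≡ univ` (closed), `α := (((d+2)L)²∕4)·t` from `PlaqSmall t` below `k`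
(`LatticeWordStokes.dist1_loopHol_le`), `hCF :=` 35j's `chainFree_atScale`: n07-e's one-scale tangent form (35c) is recovered by the local chart road. [cite: Balaban1985Variational, (82)–(83) p.290; Balaban1988Convergent, (2.2) p.255] -/
theorem hasDerivAt_wilsonAction4_expChart_of_isCritOnFibre_atScale_of_plaqSmall (hk : k ≤ (F.P K).m + (F.P K).K) {t : ℝ} (ht : 0 ≤ t)
    (hsm : ∀ i, i < k → PlaqSmall t (avgFamily (avOfRecord F N K) U i))
    (h24 : ((((F.P K).d + 2) * (F.P K).L : ℕ) : ℝ) ^ 2 / 4 * t ≤ 1 / 24) (hδ : ((((F.P K).d + 2) * (F.P K).L : ℕ) : ℝ) ^ 2 / 4 * t < deltaSU (Fin N))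
    (hL : 157 * (((((F.P K).d + 2) * (F.P K).L : ℕ) : ℝ) ^ 2 / 4 * t) < (((F.P K).L : ℝ) ^ ((F.P K).d - 1))⁻¹)
    (hU : AgreeOn (atScale k) (avgFamily (avOfRecord F N K) U) W) (hcrit : IsCritOnFibre F N K (atScale k) W U) {X : PBond (F.P K) 0 → lieSU (Fin N)}
    (hX : ∀ j, j ≤ k → ∀ c ∈ bondsOf ((atScale k : DetSet (F.P K)) j),
      HasDerivAt (fun t : ℝ => ((avgFamily (avOfRecord F N K) (expChart U (t • X)) j c : SU N) : Matrix (Fin N) (Fin N) ℂ)) 0 0) :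
    HasDerivAt (fun t : ℝ => wilsonAction4 (expChart U (t • X))) 0 0 :=
  hasDerivAt_wilsonAction4_expChart_of_isCritOnFibre_of_loopSmall (𝔹 := atScale k) (fun j hj => by ext x; simp [atScale, hj.ne']) hk hU (fun _ => Set.univ)
    (fun _ _ _ _ _ _ => Set.mem_univ _) (fun i c hi _ idx => LatticeWordStokes.dist1_loopHol_le ht (hsm i (Nat.lt_of_succ_le hi)) c idx) h24 hδ hL
    (fun j _ => Set.subset_univ _) (chainFree_atScale k) hcrit hX

end Record

end Summit.QuantumFields.YangMills.BalabanUVNodes.N07CentralResponseOnto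

end
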